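import Summits.ResolutionOfSingularities.ResolutionOfSingularities.Theorems.EquisingularLiftEquisingularLiftNatSpecimenQuarticPointStep
import Summits.ResolutionOfSingularities.ResolutionOfSingularities.Theorems.EquisingularLiftEquisingularLiftNatSpecimenWhitneyCubicForms
import Literature.AlgebraicGeometry.Motives.HypersurfaceCharts
import Literature.AlgebraicGeometry.Motives.HypersurfaceChartAlgebra
import Literature.AlgebraicGeometry.Motives.HypersurfaceFormsIrreducible
import Literature.AlgebraicGeometry.Motives.SmoothHypersurfaceIrreducible
import Literature.AlgebraicGeometry.Resolution.ComponentGluing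
import Mathlib.FieldTheory.IsAlgClosed.Basic
import HarnessLib

/-!
# [OURS · L1 W4.5(b)] T-ISO-1 forms layer: the quartic `x₀²x₃² + x₁⁴ + x₂⁴` — the form, the hypersurface, the chart rings

Helper for the research stub `stub_elnat_three_isolated_nonabs` / rung T-ISO-0⁺ of the crux `EquisingularLiftNat`
(stmt-ResolutionOfSingularities-20038; route `EquisingularLift`, chain w45b, CHAIN v7.1–7.3 §3 row T-ISO-1 «stub-4: charts
done → assembly»; the quartic is one of the two named instances of res-L1-w45b-lead-2's T-Δ-ISO / `tcDeltaPointResolution`).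
NOT a statement of any manuscript; AI-written kernel lemma of the cell `res-hironaka` (weaker than expert review).
Pattern and currency: res-D-pv-022's R2 forms layer `…NatSpecimenWhitneyCubicForms.lean` (p508519), verbatim where possible.

The specimen `H = V₊(F) ⊂ ℙ³_k`, `F = x₀²x₃² + x₁⁴ + x₂⁴` (lead-2's T-ISO-1: two isolated singular points `[0:0:0:1]`,
`[1:0:0:0]` of type `z² + x⁴ + y⁴`), as an instance of the binders of `EquisingularLiftNat`: `H` is the tree's REDUCED
hypersurface `Motives.SmoothHypersurface.hypersurface F` with its closed immersion `hypersurfaceι F` onto `V₊(F)`; for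
`char k ≠ 2` and `k` algebraically closed `F` is PRIME (Eisenstein at the rational point `(i, 1, 1)` of `x₀²x₃² + x₂⁴`, as a
monic quartic in `x₁`), so `H` is INTEGRAL. The dehomogenized equations are

  `f₀ = fSing = y₂² + y₀⁴ + y₁⁴` (`= PointStep`'s `z² + x⁴ + y⁴`), `f₃ = fSing′ = y₀² + y₁⁴ + y₂⁴` (its renaming),
  `f₁ = f₂ = fSm = y₀²y₂² + y₁⁴ + 1` (`= LineStep`'s smooth chart),

all generating RADICAL ideals (`fSing` prime by Eisenstein at `(ζ, 1)`, `ζ⁴ = −1`; `fSm` with regular quotient,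
`isRegularRing_quotient_smoothChart` p510354), whence `ChartRing F c ≅ k[y₀,y₁,y₂]/(f_c)` with the tautological coordinates
`x_{c.succAbove j}/x_c ↦ ȳ_j` (dehomogenization, Hartshorne I Thm 3.4 on the reduced induced structure II Example 3.2.6).

* `form`, `isHomogeneous_form`, `prime_form`; `fSing`, `fSing'`, `fSm`, `dehomogenize_form_*`, `prime_fSing`,
  `prime_fSing'`, `radical_span_*`;
* `isIntegral_hypersurface`; `chartQuotEquiv c` with `chartQuotEquiv_tautVec`; `chartIdeal_eq_span_all` (every chart
  ideal principal — the «locally principal» binder); `isRegularRing_chartRing_one/two` (the charts off the two points).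

NOT here: the two-step horizontal chain (sections at the two points, then the in-carrier lines) and `ELNatAt` — the
assembly proper (`elNatBody_of_twoSteps_regular` p511284, R1-IN-CARRIER p508234, T-E1-CONE p512010, the point/line-step
algebra p509438/p510354/p511135).

References: Hartshorne 1977 I Thm 3.4, II Ex. 2.9, Example 3.2.6; the cited tree files.
-/

set_option linter.dupNamespace false -- mandated namespace `Summit.<Summit>.<Problem>` of this single-conjunct summit

noncomputable section

open MvPolynomial HomogeneousLocalization
open Literature.AlgebraicGeometry.Resolution (IsRegularRing.isReduced')
open Literature.AlgebraicGeometry.Motives Literature.AlgebraicGeometry.Motives.SmoothHypersurface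
open Literature.AlgebraicGeometry.Motives.ProjectiveSpace
open Summit.ResolutionOfSingularities.ResolutionOfSingularities.Cruxes.EquisingularLiftNat.Sections (WhitneyCubic.dehomogenize_X_of_eq)

namespace Summit.ResolutionOfSingularities.ResolutionOfSingularities.Theorems.EquisingularLift.SpecimenQuartic

variable (k : Type) [Field k]

attribute [local instance] MvPolynomial.gradedAlgebra ProjBaseChange.algebraBase

/-! ## The form `F = x₀²x₃² + x₁⁴ + x₂⁴` -/

/-- **The quartic form of T-ISO-1** `F = x₀²x₃² + x₁⁴ + x₂⁴ ∈ k[x₀, x₁, x₂, x₃]` (two isolated singular points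
`[0:0:0:1]`, `[1:0:0:0]`, swapped by `x₀ ↔ x₃`). [folklore] -/
def form : MvPolynomial (Fin 4) k := X 0 ^ 2 * X 3 ^ 2 + X 1 ^ 4 + X 2 ^ 4

/-- `F` is homogeneous of degree `4`. [folklore] -/
theorem isHomogeneous_form : (form k).IsHomogeneous 4 := by
  have h1 : (X 0 ^ 2 * X 3 ^ 2 : MvPolynomial (Fin 4) k).IsHomogeneous 4 := by
    simpa using ((isHomogeneous_X k (0 : Fin 4)).pow 2).mul ((isHomogeneous_X k (3 : Fin 4)).pow 2)
  have h2 : (X 1 ^ 4 : MvPolynomial (Fin 4) k).IsHomogeneous 4 := by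
    simpa using (isHomogeneous_X k (1 : Fin 4)).pow 4
  have h3 : (X 2 ^ 4 : MvPolynomial (Fin 4) k).IsHomogeneous 4 := by
    simpa using (isHomogeneous_X k (2 : Fin 4)).pow 4
  exact (h1.add h2).add h3

/-- In `x₁`-adic form after `x₀ ↔ x₁`: `F(x₁, x₀, x₂, x₃) = Y⁴ + C(y₀²y₂² + y₁⁴)` over `k[y₀, y₁, y₂]`
(`y = (x₀, x₂, x₃)`). [folklore] -/
theorem finSuccEquiv_rename_form :
    finSuccEquiv k 3 (rename (Equiv.swap (0 : Fin 4) 1) (form k)) =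
      Polynomial.X ^ 4 + Polynomial.C (X 0 ^ 2 * X 2 ^ 2 + X 1 ^ 4) := by
  have h1 : finSuccEquiv k 3 (X 1) = Polynomial.C (X 0) := finSuccEquiv_X_succ (j := 0)
  have h2 : finSuccEquiv k 3 (X 2) = Polynomial.C (X 1) := finSuccEquiv_X_succ (j := 1)
  have h3 : finSuccEquiv k 3 (X 3) = Polynomial.C (X 2) := finSuccEquiv_X_succ (j := 2)
  simp only [form, map_add, map_mul, map_pow, rename_X, Equiv.swap_apply_left, Equiv.swap_apply_right,
    Equiv.swap_apply_of_ne_of_ne (show (2 : Fin 4) ≠ 0 by decide) (show (2 : Fin 4) ≠ 1 by decide),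
    Equiv.swap_apply_of_ne_of_ne (show (3 : Fin 4) ≠ 0 by decide) (show (3 : Fin 4) ≠ 1 by decide),
    finSuccEquiv_X_zero, h1, h2, h3]
  ring

/-- `(4 : k) ≠ 0` when `(2 : k) ≠ 0`. [folklore] -/
theorem four_ne_zero (h2 : (2 : k) ≠ 0) : (4 : k) ≠ 0 := by
  have e : (4 : k) = 2 * 2 := by norm_num
  rw [e]
  exact mul_ne_zero h2 h2

/-- **`F` is prime** in `k[x₀, …, x₃]` for `k` algebraically closed of characteristic `≠ 2`: as a monic quartic in `x₁`,
`Y⁴ + C(c)`, `c = y₀²y₂² + y₁⁴`, it is Eisenstein at the rational point `(i, 1, 1)` of `V(c)` (`i² = −1`), where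
`∂c/∂y₁ = 4 ≠ 0` (the tree's `irreducible_X_pow_add_C`). [folklore] -/
theorem prime_form [IsAlgClosed k] (h2 : (2 : k) ≠ 0) : Prime (form k) := by
  obtain ⟨i, hi⟩ := IsAlgClosed.exists_pow_nat_eq (-1 : k) (by norm_num : 0 < 2)
  have hirr : Irreducible (rename (Equiv.swap (0 : Fin 4) 1) (form k)) := by
    rw [← MulEquiv.irreducible_iff (finSuccEquiv k 3), finSuccEquiv_rename_form]
    refine irreducible_X_pow_add_C (by norm_num) _ ![i, 1, 1] ?_ 1 ?_
    · simp only [map_add, map_mul, map_pow, eval_X, Matrix.cons_val_zero, Matrix.cons_val_one,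
        Matrix.cons_val_two, Matrix.tail_cons, Matrix.head_cons, hi, one_pow, mul_one]
      ring
    · have hd : (pderiv 1 : Derivation k (MvPolynomial (Fin 3) k) _) (X 0 ^ 2 * X 2 ^ 2 + X 1 ^ 4) = 4 * X 1 ^ 3 := by
        simp [Derivation.leibniz, Derivation.leibniz_pow]
      rw [hd, map_mul, map_pow, eval_X, map_ofNat, show (![i, (1 : k), 1] : Fin 3 → k) 1 = 1 from rfl, one_pow, mul_one]
      exact four_ne_zero k h2
  have hirr' : Irreducible (form k) :=
    (MulEquiv.irreducible_iff (renameEquiv k (Equiv.swap (0 : Fin 4) 1)).toMulEquiv (x := form k)).mp hirr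
  exact UniqueFactorizationMonoid.irreducible_iff_prime.mp hirr'

/-! ## The dehomogenized equations -/

/-- The singular chart equation `fSing = y₂² + y₀⁴ + y₁⁴` (`= F(x₀ := 1)`; the `z² + x⁴ + y⁴` of `…NatSpecimenQuarticPointStep`).
[folklore] -/
def fSing : MvPolynomial (Fin 3) k := X 2 ^ 2 + X 0 ^ 4 + X 1 ^ 4

/-- The other singular chart equation `fSing′ = y₀² + y₁⁴ + y₂⁴` (`= F(x₃ := 1)`, `= fSing` with `y₀ ↔ y₂`). [folklore] -/
def fSing' : MvPolynomial (Fin 3) k := X 0 ^ 2 + X 1 ^ 4 + X 2 ^ 4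

/-- The smooth chart equation `fSm = y₀²y₂² + y₁⁴ + 1` (`= F(x₁ := 1) = F(x₂ := 1)`; the `a²c² + b⁴ + 1` of
`…NatSpecimenQuarticLineStep`). [folklore] -/
def fSm : MvPolynomial (Fin 3) k := X 0 ^ 2 * X 2 ^ 2 + X 1 ^ 4 + 1

/-- `F(x₀ := 1) = fSing` (`y = (x₁, x₂, x₃)`). [folklore] -/
theorem dehomogenize_form_zero : dehomogenize k (0 : Fin 4) (form k) = fSing k := by
  simp only [form, fSing, map_add, map_mul, map_pow, dehomogenize_X_self,
    WhitneyCubic.dehomogenize_X_of_eq k 0 1 0 (by decide), WhitneyCubic.dehomogenize_X_of_eq k 0 2 1 (by decide),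
    WhitneyCubic.dehomogenize_X_of_eq k 0 3 2 (by decide), one_pow, one_mul]

/-- `F(x₁ := 1) = fSm` (`y = (x₀, x₂, x₃)`). [folklore] -/
theorem dehomogenize_form_one : dehomogenize k (1 : Fin 4) (form k) = fSm k := by
  simp only [form, fSm, map_add, map_mul, map_pow, dehomogenize_X_self,
    WhitneyCubic.dehomogenize_X_of_eq k 1 0 0 (by decide), WhitneyCubic.dehomogenize_X_of_eq k 1 2 1 (by decide),
    WhitneyCubic.dehomogenize_X_of_eq k 1 3 2 (by decide), one_pow]
  ring

/-- `F(x₂ := 1) = fSm` (`y = (x₀, x₁, x₃)`). [folklore] -/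
theorem dehomogenize_form_two : dehomogenize k (2 : Fin 4) (form k) = fSm k := by
  simp only [form, fSm, map_add, map_mul, map_pow, dehomogenize_X_self,
    WhitneyCubic.dehomogenize_X_of_eq k 2 0 0 (by decide), WhitneyCubic.dehomogenize_X_of_eq k 2 1 1 (by decide),
    WhitneyCubic.dehomogenize_X_of_eq k 2 3 2 (by decide), one_pow]

/-- `F(x₃ := 1) = fSing′` (`y = (x₀, x₁, x₂)`). [folklore] -/
theorem dehomogenize_form_three : dehomogenize k (3 : Fin 4) (form k) = fSing' k := by
  simp only [form, fSing', map_add, map_mul, map_pow, dehomogenize_X_self,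
    WhitneyCubic.dehomogenize_X_of_eq k 3 0 0 (by decide), WhitneyCubic.dehomogenize_X_of_eq k 3 1 1 (by decide),
    WhitneyCubic.dehomogenize_X_of_eq k 3 2 2 (by decide), one_pow, mul_one]

/-! ## The chart equations generate radical ideals -/

/-- **`fSing = y₂² + y₀⁴ + y₁⁴` is prime** (`k = k̄`, `char k ≠ 2`): after `y₀ ↔ y₂` it is `Y² + C(z₀⁴ + z₁⁴)` over
`k[z₀, z₁]`, Eisenstein at the rational point `(ζ, 1)`, `ζ⁴ = −1` (`∂/∂z₀ = 4z₀³ ≠ 0` there). [folklore] -/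
theorem prime_fSing [IsAlgClosed k] (h2 : (2 : k) ≠ 0) : Prime (fSing k) := by
  obtain ⟨ζ, hζ⟩ := IsAlgClosed.exists_pow_nat_eq (-1 : k) (by norm_num : 0 < 4)
  have hζ0 : ζ ≠ 0 := by
    rintro rfl
    norm_num at hζ
  have hfin : finSuccEquiv k 2 (rename (Equiv.swap (0 : Fin 3) 2) (fSing k)) =
      Polynomial.X ^ 2 + Polynomial.C (X 1 ^ 4 + X 0 ^ 4) := by
    have h1 : finSuccEquiv k 2 (X 1) = Polynomial.C (X 0) := finSuccEquiv_X_succ (j := 0)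
    have h2' : finSuccEquiv k 2 (X 2) = Polynomial.C (X 1) := finSuccEquiv_X_succ (j := 1)
    simp only [fSing, map_add, map_pow, rename_X, Equiv.swap_apply_left, Equiv.swap_apply_right,
      Equiv.swap_apply_of_ne_of_ne (show (1 : Fin 3) ≠ 0 by decide) (show (1 : Fin 3) ≠ 2 by decide),
      finSuccEquiv_X_zero, h1, h2']
    ring
  have hirr : Irreducible (rename (Equiv.swap (0 : Fin 3) 2) (fSing k)) := by
    rw [← MulEquiv.irreducible_iff (finSuccEquiv k 2), hfin]
    refine irreducible_X_pow_add_C (by norm_num) _ ![ζ, 1] ?_ 0 ?_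
    · simp only [map_add, map_pow, eval_X, Matrix.cons_val_zero, Matrix.cons_val_one, hζ, one_pow]
      ring
    · have hd : (pderiv 0 : Derivation k (MvPolynomial (Fin 2) k) _) (X 1 ^ 4 + X 0 ^ 4) = 4 * X 0 ^ 3 := by
        simp [Derivation.leibniz_pow]
      rw [hd]
      simp only [map_mul, map_pow, eval_X, Matrix.cons_val_zero, map_ofNat]
      exact mul_ne_zero (four_ne_zero k h2) (pow_ne_zero 3 hζ0)
  have hirr' : Irreducible (fSing k) :=
    (MulEquiv.irreducible_iff (renameEquiv k (Equiv.swap (0 : Fin 3) 2)).toMulEquiv (x := fSing k)).mp hirr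
  exact UniqueFactorizationMonoid.irreducible_iff_prime.mp hirr'

/-- `fSing′` is `fSing` with `y₀ ↔ y₂`. [folklore] -/
theorem fSing'_eq_rename : fSing' k = rename (Equiv.swap (0 : Fin 3) 2) (fSing k) := by
  simp only [fSing, fSing', map_add, map_pow, rename_X, Equiv.swap_apply_left, Equiv.swap_apply_right,
    Equiv.swap_apply_of_ne_of_ne (show (1 : Fin 3) ≠ 0 by decide) (show (1 : Fin 3) ≠ 2 by decide)]
  ring

/-- **`fSing′` is prime** (transport of `prime_fSing` along the renaming). [folklore] -/
theorem prime_fSing' [IsAlgClosed k] (h2 : (2 : k) ≠ 0) : Prime (fSing' k) := by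
  rw [fSing'_eq_rename]
  exact (MulEquiv.prime_iff (renameEquiv k (Equiv.swap (0 : Fin 3) 2)).toMulEquiv).mpr (prime_fSing k h2)

/-- `(fSing)` is a radical ideal. [folklore] -/
theorem radical_span_fSing [IsAlgClosed k] (h2 : (2 : k) ≠ 0) :
    (Ideal.span {fSing k}).radical = Ideal.span {fSing k} :=
  ((Ideal.span_singleton_prime (prime_fSing k h2).ne_zero).mpr (prime_fSing k h2)).radical

/-- `(fSing′)` is a radical ideal. [folklore] -/
theorem radical_span_fSing' [IsAlgClosed k] (h2 : (2 : k) ≠ 0) :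
    (Ideal.span {fSing' k}).radical = Ideal.span {fSing' k} :=
  ((Ideal.span_singleton_prime (prime_fSing' k h2).ne_zero).mpr (prime_fSing' k h2)).radical

/-- `k[y]/(fSm)` is a regular ring (`…NatSpecimenQuarticLineStep`, `char k ≠ 2`). [folklore] -/
theorem isRegularRing_quotient_fSm (h2 : (2 : k) ≠ 0) : IsRegularRing (MvPolynomial (Fin 3) k ⧸ Ideal.span {fSm k}) :=
  isRegularRing_quotient_smoothChart k (Ne.isUnit h2)

/-- `(fSm)` is a radical ideal (its quotient is regular, hence reduced). [folklore] -/
theorem radical_span_fSm (h2 : (2 : k) ≠ 0) : (Ideal.span {fSm k}).radical = Ideal.span {fSm k} := by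
  haveI := isRegularRing_quotient_fSm k h2
  haveI := IsRegularRing.isReduced' (MvPolynomial (Fin 3) k ⧸ Ideal.span {fSm k})
  exact (Ideal.isRadical_iff_quotient_reduced _).mpr inferInstance |>.radical

/-! ## The hypersurface `H = V₊(F)` is integral -/

/-- `H = V₊(F)` (reduced induced structure) is reduced. [folklore] -/
theorem isReduced_hypersurface : AlgebraicGeometry.IsReduced (hypersurface (form k)).left :=
  Literature.AlgebraicGeometry.Resolution.ComponentGluing.isReduced_subscheme_vanishingIdeal (zeroLocusClosed (form k))

/-- **`H = V₊(F)` is an integral scheme** for `k = k̄`, `char k ≠ 2` (`F` prime ⇒ `V₊(F)` irreducible; reduced by construction).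
[folklore] -/
theorem isIntegral_hypersurface [IsAlgClosed k] (h2 : (2 : k) ≠ 0) :
    AlgebraicGeometry.IsIntegral (hypersurface (form k)).left := by
  haveI := isReduced_hypersurface k
  have hirr : IsIrreducible (Set.range (hypersurfaceι (form k)).left) := by
    rw [range_hypersurfaceι]
    exact isIrreducible_zeroLocus_of_prime _ (isHomogeneous_form k) (prime_form k h2)
  haveI : IrreducibleSpace (Set.range (hypersurfaceι (form k)).left) := Subtype.irreducibleSpace hirr
  haveI : IrreducibleSpace (hypersurface (form k)).left :=
    (hypersurfaceι (form k)).left.isClosedEmbedding.isEmbedding.toHomeomorph.irreducibleSpace_iff.mpr this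
  exact AlgebraicGeometry.isIntegral_of_irreducibleSpace_of_isReduced _

/-! ## The chart rings `ChartRing F c ≅ k[y]/(f_c)` -/

section Charts

variable (c : Fin 4) (f : MvPolynomial (Fin 3) k) (hf : dehomogenize k c (form k) = f)
  (hrad : (Ideal.span {f}).radical = Ideal.span {f})

/-- Dehomogenization takes the chart equation `F/x_c⁴` to `F(x_c := 1)`. [folklore] -/
theorem chartAlgEquiv_chartEqn :
    chartAlgEquiv k c (chartEqn (form k) c (isHomogeneous_form k)) = dehomogenize k c (form k) := by
  rw [chartEqn, isLocalizationElem_X]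
  exact (chartAlgEquiv k c).apply_symm_apply _

include hf in
/-- Under the chart isomorphism `(k[x]_{(x_c)})₀ ≅ k[y]`, `(F/x_c⁴)` goes to `(f)`. [folklore] -/
theorem map_span_chartEqn :
    (Ideal.span {chartEqn (form k) c (isHomogeneous_form k)}).map (chartAlgEquiv k c).toRingEquiv.toRingHom =
      Ideal.span {f} := by
  rw [Ideal.map_span, Set.image_singleton]
  exact congrArg (fun q => Ideal.span {q}) ((chartAlgEquiv_chartEqn k c).trans hf)

include hf hrad in
/-- **The chart ideal is `(F/x_c⁴)` itself** (`(f)` is radical). [folklore] -/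
theorem chartIdeal_eq_span :
    chartIdeal (form k) c (isHomogeneous_form k) = Ideal.span {chartEqn (form k) c (isHomogeneous_form k)} := by
  have hspan : Ideal.span {chartEqn (form k) c (isHomogeneous_form k)} =
      (Ideal.span {f}).comap (chartAlgEquiv k c).toRingEquiv.toRingHom := by
    rw [← map_span_chartEqn k c f hf]
    exact (Ideal.comap_map_of_bijective (chartAlgEquiv k c).toRingEquiv.toRingHom
      (chartAlgEquiv k c).toRingEquiv.bijective).symm
  rw [chartIdeal, hspan, ← Ideal.comap_radical, hrad]

include hf hrad in
/-- Under the chart isomorphism, the chart ideal goes to `(f)`. [folklore] -/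
theorem map_chartIdeal :
    Ideal.span {f} = (chartIdeal (form k) c (isHomogeneous_form k)).map (chartAlgEquiv k c).toRingEquiv.toRingHom := by
  rw [chartIdeal_eq_span k c f hf hrad, map_span_chartEqn k c f hf]

/-- **`ChartRing F c ≅ k[y₀, y₁, y₂]/(f)`** for `f = F(x_c := 1)` with `(f)` radical (dehomogenization on the reduced
induced structure). [folklore] -/
def chartQuotEquiv : ChartRing (form k) c (isHomogeneous_form k) ≃+* (MvPolynomial (Fin 3) k ⧸ Ideal.span {f}) :=
  Ideal.quotientEquiv _ _ (chartAlgEquiv k c).toRingEquiv (map_chartIdeal k c f hf hrad)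

/-- The chart isomorphism on classes: `[q] ↦ [q(x_c := 1)]`. [folklore] -/
theorem chartQuotEquiv_toChartRing (q : Away (MvPolynomial.homogeneousSubmodule (Fin 4) k) (X c)) :
    chartQuotEquiv k c f hf hrad (toChartRing (form k) c (isHomogeneous_form k) q) =
      Ideal.Quotient.mk _ (chartAlgEquiv k c q) :=
  Ideal.quotientEquiv_mk _ _ _ _ q

/-- **The tautological coordinate `x_{c.succAbove j}/x_c` goes to `ȳ_j`.** [folklore] -/
theorem chartQuotEquiv_tautVec (j : Fin 3) :
    chartQuotEquiv k c f hf hrad (tautVec (form k) c (isHomogeneous_form k) (c.succAbove j)) =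
      Ideal.Quotient.mk _ (X j) := by
  rw [tautVec_apply, chartQuotEquiv_toChartRing, coord_succAbove, ← chartAlgEquiv_symm_X k c j,
    AlgEquiv.apply_symm_apply]

end Charts

/-- **Every chart ideal of `H` is principal**: `(F/x_c⁴)` on `D₊(x_c)` (the «locally principal» binder of the item),
`k = k̄`, `char k ≠ 2`. [folklore] -/
theorem chartIdeal_eq_span_all [IsAlgClosed k] (h2 : (2 : k) ≠ 0) (c : Fin 4) :
    chartIdeal (form k) c (isHomogeneous_form k) = Ideal.span {chartEqn (form k) c (isHomogeneous_form k)} := by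
  fin_cases c
  · exact chartIdeal_eq_span k 0 (fSing k) (dehomogenize_form_zero k) (radical_span_fSing k h2)
  · exact chartIdeal_eq_span k 1 (fSm k) (dehomogenize_form_one k) (radical_span_fSm k h2)
  · exact chartIdeal_eq_span k 2 (fSm k) (dehomogenize_form_two k) (radical_span_fSm k h2)
  · exact chartIdeal_eq_span k 3 (fSing' k) (dehomogenize_form_three k) (radical_span_fSing' k h2)

/-- **The chart rings off the two singular points are regular**: `ChartRing F 1 ≅ ChartRing F 2 ≅ k[y]/(fSm)`
(`char k ≠ 2`). [folklore] -/
theorem isRegularRing_chartRing_one (h2 : (2 : k) ≠ 0) :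
    IsRegularRing (ChartRing (form k) 1 (isHomogeneous_form k)) := by
  haveI := isRegularRing_quotient_fSm k h2
  exact IsRegularRing.of_ringEquiv (chartQuotEquiv k 1 (fSm k) (dehomogenize_form_one k) (radical_span_fSm k h2)).symm

/-- See `isRegularRing_chartRing_one`. [folklore] -/
theorem isRegularRing_chartRing_two (h2 : (2 : k) ≠ 0) :
    IsRegularRing (ChartRing (form k) 2 (isHomogeneous_form k)) := by
  haveI := isRegularRing_quotient_fSm k h2
  exact IsRegularRing.of_ringEquiv (chartQuotEquiv k 2 (fSm k) (dehomogenize_form_two k) (radical_span_fSm k h2)).symm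

end Summit.ResolutionOfSingularities.ResolutionOfSingularities.Theorems.EquisingularLift.SpecimenQuartic

end
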